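import Summits.CriticalPhenomena.PercolationContinuityZ3.Theorems.Transplant.FKConnectivityAllQAntipodalX2SpineDefs
import HarnessLib

/-!
# Connectivity correlation inequalities for `φ_{w,q}` — the spine of a marked edge, file 7: ROW-WORD COMBINATORICS (adjacent particle
# pairs versus runs, the rows of the σ-word of a configuration, row exchange, particle counts under flips, the words of a shape)

Helper file (`--supports stmt-CriticalPhenomena-4575`), FK sub-lane `prim-bschramm-fk-2` (gen 14); builds on p205010 (kernel
theorem, internal audit signed; external expert review pending).  No definitions, no named facts, no sorries; pure list combinatorics.

* `FK.adjP_add_runsAux` — `adjP b l + runsAux b l = #P(l)` (so `corr = #P - #runs` of memo g12 §4.2 is the adjacent-pair count);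
* `FK.sRowA_spineWord`, `FK.sRowB_spineWord` — the rows of the σ-word of `B` are the row words of `B` and of `T ∖ B`;
* `FK.spineWord_sdiff` — the word of `T ∖ B` is the row-exchanged word of `B`; `FK.sRowA_map_swapLetter`, `FK.nP_map_swapLetter`,
  `FK.sRuns_map_swapLetter`, `FK.cross_sub_cross_swap` (the `X2` sign `1{C(b)}1{¬K(b̄)} - 1{C(b̄)}1{¬K(b)}` is `sSign`);
* `FK.nP_eq_of_forall₂_flip` — flips `01 → 10` keep the number of particles;
* `FK.mem_allWords_iff` (the words of a shape are the words with the shape's kinds), `FK.spineWord_mem_allWords`,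
  `FK.map_fst_eq_of_forall₂_flip`.
[cite: Grimmett2006, §3.9 (p. 63)]
-/

namespace Summit.CriticalPhenomena.PercolationContinuityZ3.Theorems

namespace FK

open SimpleGraph Literature.Probability.LatticeModels Literature.Probability.Percolation X2Word
open scoped Classical

variable {V : Type*}

/-! ### Adjacent particle pairs versus runs -/

/-- **`adjP b l + runsAux b l = #P(l)`**: every particle either opens a new run or is adjacent to the particle before it. [folklore] -/
theorem adjP_add_runsAux (b : Bool) (l : List Kind) : adjP b l + runsAux b l = l.count .P := by
  induction l generalizing b with
  | nil => rfl
  | cons k l ih =>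
    cases k with
    | P =>
      have h := ih true
      simp only [adjP, runsAux, List.count_cons_self]
      cases b <;> simp <;> omega
    | W =>
      have h := ih false
      simp only [adjP, runsAux]
      rw [List.count_cons_of_ne (by decide)]
      exact h

/-- `adjP false l + runsP l = #P(l)`. [folklore] -/
theorem adjP_add_runsP (l : List Kind) : adjP false l + runsP l = l.count .P := adjP_add_runsAux false l

/-! ### The rows of the σ-word of a configuration -/

section Rows

variable (ps : List (SpinePart V)) (T B : Finset (Sym2 V))

/-- Row `A` of the σ-word of `B` is the row word of `B`. [folklore] -/
theorem sRowA_spineWord : sRowA (spineWord ps T B) = rowOf ps B := by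
  induction ps with
  | nil => rfl
  | cons p ps ih =>
    rw [spineWord_cons, sRowA_cons, rowOf_cons, ih]
    simp only [SpinePart.letter, sVisA_eq]

/-- Row `B` of the σ-word of `B` is the row word of `T ∖ B`. [folklore] -/
theorem sRowB_spineWord : sRowB (spineWord ps T B) = rowOf ps (T \ B) := by
  induction ps with
  | nil => rfl
  | cons p ps ih =>
    rw [spineWord_cons, sRowB_cons, rowOf_cons, ih]
    simp only [SpinePart.letter, sVisB_eq]

variable {T B} in
/-- The σ-word of the complement is the row-exchanged word. [folklore] -/
theorem spineWord_sdiff (hB : B ⊆ T) : spineWord ps T (T \ B) = (spineWord ps T B).map swapLetter := by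
  unfold spineWord
  rw [List.map_map]
  refine List.map_congr_left fun p _ => ?_
  simp only [Function.comp, SpinePart.letter, swapLetter, Finset.sdiff_sdiff_eq_self hB]

end Rows

/-! ### Row exchange -/

/-- Exchanging the rows letterwise exchanges the rows. [folklore] -/
theorem sRowA_map_swapLetter (w : List SLetter) : sRowA (w.map swapLetter) = sRowB w := by
  induction w with
  | nil => rfl
  | cons l w ih =>
    obtain ⟨k, b, bb⟩ := l
    rw [List.map_cons, sRowA_cons, sRowB_cons, ih]
    simp only [swapLetter, sVisA_eq, sVisB_eq]

/-- Exchanging the rows letterwise exchanges the rows. [folklore] -/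
theorem sRowB_map_swapLetter (w : List SLetter) : sRowB (w.map swapLetter) = sRowA w := by
  induction w with
  | nil => rfl
  | cons l w ih =>
    obtain ⟨k, b, bb⟩ := l
    rw [List.map_cons, sRowA_cons, sRowB_cons, ih]
    simp only [swapLetter, sVisA_eq, sVisB_eq]

/-- The particle count is symmetric under row exchange. [folklore] -/
theorem nP_map_swapLetter (w : List SLetter) : nP (w.map swapLetter) = nP w := by
  unfold nP; rw [sRowA_map_swapLetter, sRowB_map_swapLetter, Nat.add_comm]

/-- The run count is symmetric under row exchange. [folklore] -/
theorem sRuns_map_swapLetter (w : List SLetter) : sRuns (w.map swapLetter) = sRuns w := by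
  unfold sRuns; rw [sRowA_map_swapLetter, sRowB_map_swapLetter, Nat.add_comm]

/-- **The sign of `X2` through the word**: `1{C(b)}·1{¬K(b̄)} - 1{C(b̄)}·1{¬K(b)} = sSign` (`+1` on winners, `-1` on losers; memo g12 §4.2). [folklore] -/
theorem cross_sub_cross_swap (w : List SLetter) :
    ((if lastP (sRowA w) then (1 : ℝ) else 0) * (1 - if headP (sRowB w) then (1 : ℝ) else 0)) -
      ((if lastP (sRowA (w.map swapLetter)) then (1 : ℝ) else 0) *
        (1 - if headP (sRowB (w.map swapLetter)) then (1 : ℝ) else 0)) = sSign w := by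
  rw [sRowA_map_swapLetter, sRowB_map_swapLetter]
  unfold sSign sIsWinner sIsLoser
  cases lastP (sRowA w) <;> cases headP (sRowB w) <;> cases lastP (sRowB w) <;> cases headP (sRowA w) <;> norm_num

/-! ### Particle counts under flips -/

/-- The particle count, one letter at a time. [folklore] -/
theorem nP_cons (l : SLetter) (w : List SLetter) :
    nP (l :: w) = ((if sVisA l then [l.1] else []).count .P + (if sVisB l then [l.1] else []).count .P) + nP w := by
  unfold nP
  rw [sRowA_cons, sRowB_cons, List.count_append, List.count_append]
  omega

/-- **Flips `01 → 10` keep the number of particles** (a series flip moves a wall, a parallel flip moves a particle, between the rows). [folklore] -/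
theorem nP_eq_of_forall₂_flip {w w' : List SLetter}
    (h : List.Forall₂ (fun a b : SLetter => b = a ∨ (a.2 = (false, true) ∧ b = (a.1, true, false))) w w') : nP w' = nP w := by
  induction h with
  | nil => rfl
  | @cons a b w w' hab _ ih =>
    rw [nP_cons, nP_cons, ih]
    rcases hab with rfl | ⟨ha, rfl⟩
    · rfl
    · obtain ⟨k, x, y⟩ := a
      simp only [Prod.mk.injEq] at ha
      obtain ⟨rfl, rfl⟩ := ha
      cases k <;> simp [sVisA, sVisB]

/-! ### The words of a shape -/

/-- **The words of the shape of `ps` are the words with its kind sequence.** [folklore] -/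
theorem mem_allWords_iff (ps : List (SpinePart V)) (w : List SLetter) :
    w ∈ allWords ps ↔ w.map (·.1) = ps.map (·.kind) := by
  induction ps generalizing w with
  | nil =>
    rw [allWords_nil, Finset.mem_singleton, List.map_nil, List.map_eq_nil_iff]
  | cons p ps ih =>
    rw [mem_allWords_cons, List.map_cons]
    constructor
    · rintro ⟨b, bb, w', hw', rfl⟩
      rw [List.map_cons, (ih w').1 hw']
    · intro hw
      cases w with
      | nil => simp at hw
      | cons l w' =>
        rw [List.map_cons, List.cons.injEq] at hw
        refine ⟨l.2.1, l.2.2, w', (ih w').2 hw.2, ?_⟩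
        rw [← hw.1]

/-- The σ-word of a configuration is a word of the spine's shape. [folklore] -/
theorem spineWord_mem_allWords (ps : List (SpinePart V)) (T B : Finset (Sym2 V)) : spineWord ps T B ∈ allWords ps := by
  rw [mem_allWords_iff]
  unfold spineWord
  rw [List.map_map]
  exact List.map_congr_left fun p _ => rfl

/-- Flips keep the kind sequence. [folklore] -/
theorem map_fst_eq_of_forall₂_flip {w w' : List SLetter}
    (h : List.Forall₂ (fun a b : SLetter => b = a ∨ (a.2 = (false, true) ∧ b = (a.1, true, false))) w w') :
    w'.map (·.1) = w.map (·.1) := by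
  induction h with
  | nil => rfl
  | @cons a b w w' hab _ ih =>
    rw [List.map_cons, List.map_cons, ih]
    rcases hab with rfl | ⟨_, rfl⟩
    · rfl
    · rfl

/-- Flips keep the shape: the flipped word is again a word of the spine's shape. [folklore] -/
theorem mem_allWords_of_forall₂_flip {ps : List (SpinePart V)} {w w' : List SLetter} (hw : w ∈ allWords ps)
    (h : List.Forall₂ (fun a b : SLetter => b = a ∨ (a.2 = (false, true) ∧ b = (a.1, true, false))) w w') :
    w' ∈ allWords ps := by
  rw [mem_allWords_iff] at hw ⊢
  rw [map_fst_eq_of_forall₂_flip h, hw]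

end FK

end Summit.CriticalPhenomena.PercolationContinuityZ3.Theorems
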